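import Summits.Ventures.PercRepro.MSTightDichotomy

/-!
# Splitting a two-family difference family along an element

Dossier proofs/MINE1-theoremS.md, Addendum 49 (the toolkit of the two-family Marica–Schönheim
inequality, proved in `MSTightTwoFamily`). For families `S, T` of finite sets and an element `r`
(`S₀ = part0 r S` = the members avoiding `r`, `S₁ = partr r S` = the members containing `r` with
`r` removed, `S \\ T = {s \ t : s ∈ S, t ∈ T}`), the difference family splits into its `r`-free
part and its `r`-part:
`part0 r (S \\ T) = S₀ \\ T₀ ∪ S₁ \\ T₁ ∪ S₀ \\ T₁ =: diffsX₂ r S T` and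
`partr r (S \\ T) = S₁ \\ T₀ =: diffsY₂ r S T` (`part0_diffs`, `partr_diffs`; the case `S = T` is
p4's `diffs_filter_notMem` / `diffs_filter_mem`), so `|S \\ T| = |diffsX₂ r S T| + |diffsY₂ r S T|`
(`card_diffs_eq_card_X₂_add_card_Y₂`); `part0` and `partr` commute with `\` and `∪` of families;
the differences of the projections are `diffsX₂ ∪ diffsY₂` (`diffs_proj_eq₂`); and the members of
`proj r F` and of `partner r F` lie in `U` when those of `F` lie in `insert r U`.
-/

namespace PercRepro.MSTight

open Finset
open scoped FinsetFamily

variable {α : Type*} [DecidableEq α]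

/-- The `r`-free differences of `S` against `T`: `S₀ \\ T₀ ∪ S₁ \\ T₁ ∪ S₀ \\ T₁`. -/
def diffsX₂ (r : α) (S T : Finset (Finset α)) : Finset (Finset α) :=
  part0 r S \\ part0 r T ∪ partr r S \\ partr r T ∪ part0 r S \\ partr r T

/-- The `r`-differences of `S` against `T`, with `r` removed: `S₁ \\ T₀`. -/
def diffsY₂ (r : α) (S T : Finset (Finset α)) : Finset (Finset α) := partr r S \\ part0 r T

/-- `diffsX₂ r F F` is `diffsX r F`. -/
theorem diffsX₂_self (r : α) (F : Finset (Finset α)) : diffsX₂ r F F = diffsX r F := rfl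

/-- `diffsY₂ r F F` is `diffsY r F`. -/
theorem diffsY₂_self (r : α) (F : Finset (Finset α)) : diffsY₂ r F F = diffsY r F := rfl

/-- **The `r`-free differences of `S` against `T`.** -/
theorem part0_diffs (r : α) (S T : Finset (Finset α)) :
    part0 r (S \\ T) = diffsX₂ r S T := by
  ext E
  simp only [mem_part0, Finset.mem_diffs, diffsX₂, Finset.mem_union, mem_partr]
  constructor
  · rintro ⟨⟨A, hA, B, hB, rfl⟩, hr⟩
    by_cases hrA : r ∈ A
    · have hrB : r ∈ B := by
        by_contra hrB
        exact hr (Finset.mem_sdiff.2 ⟨hrA, hrB⟩)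
      left; right
      refine ⟨A.erase r, ⟨Finset.notMem_erase r A, by rw [Finset.insert_erase hrA]; exact hA⟩,
        B.erase r, ⟨Finset.notMem_erase r B, by rw [Finset.insert_erase hrB]; exact hB⟩, ?_⟩
      ext x
      simp only [Finset.mem_sdiff, Finset.mem_erase]
      constructor
      · rintro ⟨⟨hxr, hxA⟩, hxB⟩
        exact ⟨hxA, fun h => hxB ⟨hxr, h⟩⟩
      · rintro ⟨hxA, hxB⟩
        have hxr : x ≠ r := by rintro rfl; exact hxB hrB
        exact ⟨⟨hxr, hxA⟩, fun h => hxB h.2⟩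
    · by_cases hrB : r ∈ B
      · right
        refine ⟨A, ⟨hA, hrA⟩, B.erase r,
          ⟨Finset.notMem_erase r B, by rw [Finset.insert_erase hrB]; exact hB⟩, ?_⟩
        ext x
        simp only [Finset.mem_sdiff, Finset.mem_erase]
        constructor
        · rintro ⟨hxA, hxB⟩
          have hxr : x ≠ r := by rintro rfl; exact hrA hxA
          exact ⟨hxA, fun h => hxB ⟨hxr, h⟩⟩
        · rintro ⟨hxA, hxB⟩
          exact ⟨hxA, fun h => hxB h.2⟩
      · left; left
        exact ⟨A, ⟨hA, hrA⟩, B, ⟨hB, hrB⟩, rfl⟩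
  · rintro ((⟨A, ⟨hA, hrA⟩, B, ⟨hB, hrB⟩, rfl⟩ | ⟨A, ⟨hrA, hA⟩, B, ⟨hrB, hB⟩, rfl⟩) |
      ⟨A, ⟨hA, hrA⟩, B, ⟨hrB, hB⟩, rfl⟩)
    · exact ⟨⟨A, hA, B, hB, rfl⟩, fun h => hrA (Finset.mem_sdiff.1 h).1⟩
    · refine ⟨⟨insert r A, hA, insert r B, hB, ?_⟩, fun h => hrA (Finset.mem_sdiff.1 h).1⟩
      ext x
      simp only [Finset.mem_sdiff, Finset.mem_insert]
      constructor
      · rintro ⟨(rfl | hxA), hxB⟩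
        · exact absurd (Or.inl rfl) hxB
        · exact ⟨hxA, fun h => hxB (Or.inr h)⟩
      · rintro ⟨hxA, hxB⟩
        have hxr : x ≠ r := by rintro rfl; exact hrA hxA
        exact ⟨Or.inr hxA, fun h => h.elim hxr hxB⟩
    · refine ⟨⟨A, hA, insert r B, hB, ?_⟩, fun h => hrA (Finset.mem_sdiff.1 h).1⟩
      ext x
      simp only [Finset.mem_sdiff, Finset.mem_insert]
      constructor
      · rintro ⟨hxA, hxB⟩
        exact ⟨hxA, fun h => hxB (Or.inr h)⟩
      · rintro ⟨hxA, hxB⟩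
        have hxr : x ≠ r := by rintro rfl; exact hrA hxA
        exact ⟨hxA, fun h => h.elim hxr hxB⟩

/-- **The `r`-differences of `S` against `T`, with `r` removed.** -/
theorem partr_diffs (r : α) (S T : Finset (Finset α)) :
    partr r (S \\ T) = diffsY₂ r S T := by
  ext E
  simp only [mem_partr, Finset.mem_diffs, diffsY₂, mem_part0]
  constructor
  · rintro ⟨hrE, A, hA, B, hB, hAB⟩
    have hrA : r ∈ A := by
      have : r ∈ A \ B := by rw [hAB]; exact Finset.mem_insert_self r E
      exact (Finset.mem_sdiff.1 this).1
    have hrB : r ∉ B := by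
      have : r ∈ A \ B := by rw [hAB]; exact Finset.mem_insert_self r E
      exact (Finset.mem_sdiff.1 this).2
    refine ⟨A.erase r, ⟨Finset.notMem_erase r A, by rw [Finset.insert_erase hrA]; exact hA⟩,
      B, ⟨hB, hrB⟩, ?_⟩
    have h := congrArg (fun S => S.erase r) hAB
    simp only [Finset.erase_insert hrE] at h
    rw [← h]
    ext x
    simp only [Finset.mem_sdiff, Finset.mem_erase]
    constructor
    · rintro ⟨⟨hxr, hxA⟩, hxB⟩
      exact ⟨hxr, hxA, hxB⟩
    · rintro ⟨hxr, hxA, hxB⟩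
      exact ⟨⟨hxr, hxA⟩, hxB⟩
  · rintro ⟨A, ⟨hrA, hA⟩, B, ⟨hB, hrB⟩, rfl⟩
    refine ⟨fun h => hrA (Finset.mem_sdiff.1 h).1, insert r A, hA, B, hB, ?_⟩
    ext x
    simp only [Finset.mem_sdiff, Finset.mem_insert]
    constructor
    · rintro ⟨(rfl | hxA), hxB⟩
      · exact Or.inl rfl
      · exact Or.inr ⟨hxA, hxB⟩
    · rintro (rfl | ⟨hxA, hxB⟩)
      · exact ⟨Or.inl rfl, hrB⟩
      · exact ⟨Or.inr hxA, hxB⟩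

/-- `|S \\ T| = |diffsX₂ r S T| + |diffsY₂ r S T|`. -/
theorem card_diffs_eq_card_X₂_add_card_Y₂ (r : α) (S T : Finset (Finset α)) :
    (S \\ T).card = (diffsX₂ r S T).card + (diffsY₂ r S T).card := by
  rw [card_eq_card_part0_add_card_partr r, part0_diffs, partr_diffs]

/-- `part0` commutes with set difference of families. -/
theorem part0_sdiff (r : α) (G H : Finset (Finset α)) :
    part0 r (G \ H) = part0 r G \ part0 r H := by
  ext E
  simp only [mem_part0, Finset.mem_sdiff]
  tauto

/-- `partr` commutes with set difference of families. -/
theorem partr_sdiff (r : α) (G H : Finset (Finset α)) :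
    partr r (G \ H) = partr r G \ partr r H := by
  ext E
  simp only [mem_partr, Finset.mem_sdiff]
  tauto

/-- `part0` commutes with union of families. -/
theorem part0_union (r : α) (G H : Finset (Finset α)) :
    part0 r (G ∪ H) = part0 r G ∪ part0 r H := by
  ext E
  simp only [mem_part0, Finset.mem_union]
  tauto

/-- `partr` commutes with union of families. -/
theorem partr_union (r : α) (G H : Finset (Finset α)) :
    partr r (G ∪ H) = partr r G ∪ partr r H := by
  ext E
  simp only [mem_partr, Finset.mem_union]
  tauto

/-- The differences of the projections are `X₂ ∪ Y₂`. -/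
theorem diffs_proj_eq₂ (r : α) (S T : Finset (Finset α)) :
    proj r S \\ proj r T = diffsX₂ r S T ∪ diffsY₂ r S T := by
  rw [proj_eq_union, proj_eq_union, Finset.diffs_union_left, Finset.diffs_union_right,
    Finset.diffs_union_right, diffsX₂, diffsY₂]
  ext E
  simp only [Finset.mem_union]
  tauto

/-- Members of `proj r F` are contained in `U` when the members of `F` are contained in
`insert r U`. -/
theorem proj_subset_of_subset_insert {r : α} {U : Finset α} (hr : r ∉ U)
    {F : Finset (Finset α)} (hF : ∀ A ∈ F, A ⊆ insert r U) :
    ∀ A ∈ proj r F, A ⊆ U := by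
  intro A hA
  obtain ⟨B, hB, rfl⟩ := mem_proj.1 hA
  have := Finset.erase_subset_erase r (hF B hB)
  rwa [Finset.erase_insert hr] at this

/-- Members of `partner r F` are contained in `U` when the members of `F` are contained in
`insert r U`. -/
theorem partner_subset_of_subset_insert {r : α} {U : Finset α}
    {F : Finset (Finset α)} (hF : ∀ A ∈ F, A ⊆ insert r U) :
    ∀ A ∈ partner r F, A ⊆ U := by
  intro A hA
  have h0 := mem_part0.1 (Finset.mem_inter.1 hA).1
  intro x hx
  have := hF A h0.1 hx
  rcases Finset.mem_insert.1 this with rfl | hxU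
  · exact absurd hx h0.2
  · exact hxU

end PercRepro.MSTight
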